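/-
Copyright: the b2b-balaban cell (near-miss cell 7), T⁴-continuum fan-out, round-2 swarm seat t4-ne7b-formalise-leaf-09
(row S3 of the lineage t4-ne7b-p1's claim table `t4/b2b-balaban-t4-ne7b-p1/LEAVES-NE7b.md`; node U5c COUNT member).
Released under the licence of the surrounding project.
-/
import Summits.QuantumFields.BalabanUV.T4Continuum.Support.HistoryGenFresh

/-!
# History genealogies, part 4: timing on the pedigree — `ConsistentT`, `WF`, the canonical chronology, one shape map

Summits-side support leaf of the T⁴-continuum cell (rung (B)+1 on a FINITE torus only; NOT infinite volume, NOT the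
mass gap, NOT the Clay statement; NOT a proof of the spine estimate NE7b).  Round-2 swarm `t4-ne7b-formalise-*`, row S3
«H2a the genealogy of a live component» (claim table `t4/b2b-balaban-t4-ne7b-p1/LEAVES-NE7b.md`, seat leaf-09); part 4
(parts 1–3: `Support/HistoryChain.lean`, `Support/HistoryGen.lean`, `Support/HistoryGenFresh.lean`).  By the owner's
rulings R-OWNER-22-1 (the assembly targets the TAGGED tree count, `CountThresholdExit.relWeightBound_lateMergers_of_
irThreshold` at `D = 0`, socket v3 `LiveHistoriesTH` over `Gen ε` with a shape map `sh`) and R-OWNER-22-4 (the pedigree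
`Pedigree α π` with `genT`∕`gen` of part 2 is THE H1 data structure the assembly instantiates; the timing predicates
are stated ON THE PEDIGREE as displayed hypotheses), this file supplies, for `ε := Lab α π`, `sh := Prod.fst`:
* §1 chain level: `consistentT_chainMerge` (`T4TaggedShapeBanking.ConsistentT` of a chain of consistent members alive
  at the join step), `maxStep_le_of_eventsLE`, `chronoC_chainMerge` (`T4CanonicalMenus.Chrono` of a chain headed by its
  OLDEST member);
* §2 **`structure Pedigree.Timed K W`** — the DISPLAYED timing facts (a parametrised predicate on OUR data, not a
  fact): every component observed by the cutoff; a renewed old part is of the previous step and is renewed exactly at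
  the BOOKED reach of its line (`renew_reach` = the owner's `RenewAtReach`, finding F-ne7bp1g22-1(c) displayed, row
  S4c repairs it); an old part continued into a join is pending at the join step (`alive` = `JoinInLife`) — and
  **`consistentT_genT : P.Timed K (dictWT Prod.fst R C.n₁) → ConsistentT Prod.fst C K R (P.genT c)`**,
  **`wf_genT`** (with part 3's `freshT_genT` on a forest, by `LateMergers.wf_of_consistentT_freshT`) — the socket's
  member fields `ConsistentT`∕`FreshT`∕`WF` for every component (row S4's live-family wrapper consumes them);
* §3 **`Pedigree.HeadOldest`** (oldest line first; a join is headed by an OLD part) and **`chronoC_genT`**: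
  `T4CanonicalMenus.Chrono (PEv.step ∘ Prod.fst) (P.genT c)` — the membership half of the tree count's `canonFam`
  (`T4CanonicalMenus.mem_canonFam_of_chrono`), `maxStep_genT_le`;
* §4 **ONE SHAPE FUNCTION** (R-OWNER-22-1 R3): `relabel_congr`, `relabel_eq_gmap'`, `shape_fst_of_mem_events` (kinds
  1∕2 already carry class 0) and **`relabel_shape_genT : relabel (shape ∘ Prod.fst) (P.genT c) = P.gen c`**.
The optional bridge to the census carrier `HistoryAdmissible.PGen` is `Support/HistoryGenBridge.lean`.

LOCATED (for the owner ∕ S6 pt 3, journal): `T4CanonicalMenus.Chrono`'s merger clause `X.rootStep < st e` is STRICT, so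
`HeadOldest` asks a component with several parts to be headed by an OLD part — a component assembled AT ITS BIRTH STEP
from several new regions is outside the sub-class (ruling requested).  NOT DONE HERE: pendency `K < reach` of the live
components (displayed; the geometric layer), zones (S6), slots (S7), the assembly.  NE7b discharge: no date.

HONEST DEPENDENCY (cell): continuum YM on T⁴ ⇐ BetaPertH ∧ nine spine estimates (0/9 proved); BetaPertH ⇐ (D1) ∧ (D4)
∧ CAP+tail.  This file changes none of it.
-/

open Finset
open Literature.MathematicalPhysics.QuantumFieldTheory.Balaban1983to89
open T4PersistenceDictionary T4PrintedShapeBanking T4TaggedShapeBanking T4BranchingRecordsGas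
open Summit.QuantumFields.BalabanUV.T4Continuum.ZoneSkeleton
open Summit.QuantumFields.BalabanUV.T4Continuum.HistoryChrono
open Summit.QuantumFields.BalabanUV.T4Continuum.LateMergers

namespace Summit.QuantumFields.BalabanUV.T4Continuum.HistoryGen

/-! ## §1 Consistency of a chain at one step -/

section Chain

variable {ε : Type*} {sh : ε → PEv} {C : T4PrintedShapeBanking.Consts} {K : ℕ} {R : ℕ → ℕ}

/-- **A CHAIN OF CONSISTENT MEMBERS ALIVE AT THE JOIN STEP IS CONSISTENT** (`T4TaggedShapeBanking.ConsistentT`): members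
consistent, born no later than `s` and pending at `s` for the tagged table, merger events of kind `2` dated `s ≤ K`.
[folklore] -/
theorem consistentT_chainMerge {s : ℕ} (hs : s ≤ K) : ∀ {G : Gen ε} {Hs : List (Gen ε)} {t : ℕ → ε},
    ConsistentT sh C K R G → G.rootStep ≤ s → s < G.reach (dictWT sh R C.n₁) →
      (∀ H ∈ Hs, ConsistentT sh C K R H ∧ H.rootStep ≤ s ∧ s < H.reach (dictWT sh R C.n₁)) →
      (∀ i < Hs.length, (sh (t i)).kind = 2 ∧ (sh (t i)).step = s) → ConsistentT sh C K R (chainMerge G Hs t)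
  | _, [], _, hG, _, _, _, _ => hG
  | G, H :: Hs, t, hG, hGr, hGl, hHs, ht => by
      rw [chainMerge_cons]
      obtain ⟨hH, hHr, hHl⟩ := hHs H List.mem_cons_self
      obtain ⟨hk, hst⟩ := ht 0 (by simp)
      refine consistentT_chainMerge hs ?_ ?_ ?_ (fun H' hH' => hHs H' (List.mem_cons_of_mem _ hH'))
        fun i hi => ht (i + 1) (by simpa using hi)
      · simp only [ConsistentT]
        exact ⟨hG, hH, hk, hst ▸ hGr, hst ▸ hGl, hst ▸ hHr, hst ▸ hHl, hst ▸ hs⟩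
      · rw [Gen.rootStep_merge]; exact (min_le_left _ _).trans hGr
      · rw [Gen.reach_merge]; exact hGl.trans_le ((le_max_left _ _).trans (Nat.le_add_right _ _))

/-- the latest event step of a structure all of whose events are dated `≤ n` is `≤ n` [folklore] -/
theorem maxStep_le_of_eventsLE [DecidableEq ε] {st : ε → ℕ} {n : ℕ} :
    ∀ {G : Gen ε}, EventsLE st n G → T4CanonicalMenus.maxStep st G ≤ n
  | Gen.born b j, h => by simpa using h
  | Gen.renew G e k, h => by
      rw [eventsLE_renew] at h
      rw [T4CanonicalMenus.maxStep_renew]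
      exact max_le (maxStep_le_of_eventsLE h.2) h.1
  | Gen.merge X Y e, h => by
      rw [eventsLE_merge] at h
      rw [T4CanonicalMenus.maxStep_merge]
      exact max_le (max_le (maxStep_le_of_eventsLE h.2.1) (maxStep_le_of_eventsLE h.2.2)) h.1

/-- **A CHAIN WITH THE OLDEST MEMBER FIRST IS CANONICALLY CHRONOLOGICAL** (`T4CanonicalMenus.Chrono`, the time order of
the tree count): head chronological, born strictly before `s` and no later than any member, all members chronological
with events dated `≤ s`, merger events dated `s`. [folklore] -/
theorem chronoC_chainMerge [DecidableEq ε] {st : ε → ℕ} {s : ℕ} : ∀ {G : Gen ε} {Hs : List (Gen ε)} {t : ℕ → ε},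
    T4CanonicalMenus.Chrono st G → G.rootStep < s → T4CanonicalMenus.maxStep st G ≤ s →
      (∀ H ∈ Hs, T4CanonicalMenus.Chrono st H ∧ G.rootStep ≤ H.rootStep ∧ T4CanonicalMenus.maxStep st H ≤ s) →
      (∀ i < Hs.length, st (t i) = s) → T4CanonicalMenus.Chrono st (chainMerge G Hs t)
  | _, [], _, hG, _, _, _, _ => hG
  | G, H :: Hs, t, hG, hGs, hGm, hHs, ht => by
      rw [chainMerge_cons]
      obtain ⟨hH, hGH, hHm⟩ := hHs H List.mem_cons_self
      have h0 : st (t 0) = s := ht 0 (by simp)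
      have hroot : (Gen.merge G H (t 0)).rootStep = G.rootStep := by
        rw [Gen.rootStep_merge]; exact min_eq_left hGH
      refine chronoC_chainMerge ?_ (by rw [hroot]; exact hGs) ?_
        (fun H' hH' => ?_) fun i hi => ht (i + 1) (by simpa using hi)
      · rw [T4CanonicalMenus.chrono_merge_iff]
        exact ⟨hG, hH, hGH, h0 ▸ hGs, h0 ▸ hGm, h0 ▸ hHm⟩
      · rw [T4CanonicalMenus.maxStep_merge, h0]; exact max_le (max_le hGm hHm) le_rfl
      · obtain ⟨h1, h2, h3⟩ := hHs H' (List.mem_cons_of_mem _ hH')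
        exact ⟨h1, by rw [hroot]; exact h2, h3⟩

end Chain

/-! ## §2 Timing on the pedigree, and the consistency ∕ well-formedness of the tagged genealogy -/

section Timed

variable {α π : Type*} (P : Pedigree α π)

namespace Pedigree

/-- **THE DISPLAYED TIMING FACTS ON THE PEDIGREE** (the owner's `RenewAtReach` ∕ `JoinInLife` ∕ `Adm` read FORWARD on
the adopted structure, R-OWNER-22-4; the geometric layer derives them, row S6 part 3): every component is observed by
the cutoff (`step_le`); a renewed old part is a component of the PREVIOUS step (`renew_step`) renewed exactly at the
BOOKED reach of its line (`renew_reach` = `RenewAtReach`, finding F-1(c) displayed); an old part continued into a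
component with several parts is still PENDING at the join step for the booked table (`alive` = `JoinInLife`).  A
parametrised predicate on our data, not a fact. [folklore] -/
structure Timed (K : ℕ) (W : Lab α π → ℕ) : Prop where
  /-- every component is observed by the cutoff -/
  step_le : ∀ c, P.step c ≤ K
  /-- a renewed old part is a component of the previous step -/
  renew_step : ∀ c c', Part.old c' true ∈ P.parts c → P.step c' + 1 = P.step c
  /-- … renewed exactly at the booked reach of its line -/
  renew_reach : ∀ c c', Part.old c' true ∈ P.parts c → P.step c = (P.genT c').reach W
  /-- an old part continued into a join is pending at the join step -/
  alive : ∀ c c', Part.old c' false ∈ P.parts c → 2 ≤ (P.parts c).length → P.step c < (P.genT c').reach W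

variable {P} {C : T4PrintedShapeBanking.Consts} {K : ℕ} {R : ℕ → ℕ}

/-- the tagged table reads the dictionary's table on the shape [folklore] -/
theorem dictWT_fst (R : ℕ → ℕ) (n₁ : ℕ) (e : Lab α π) : dictWT Prod.fst R n₁ e = dictW R n₁ e.1 := rfl

/-- **THE TAGGED GENEALOGY OF A TIMED PEDIGREE IS `ConsistentT`** for the shape map `Prod.fst` and the run's table.
[folklore] -/
theorem consistentT_genT (hT : P.Timed K (dictWT Prod.fst R C.n₁)) (c : α) :
    ConsistentT Prod.fst C K R (P.genT c) := by
  rw [genT_eq]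
  -- every part genealogy is consistent, born no later than `step c`; in a join every part is pending at `step c`
  have hpart : ∀ (i : ℕ) (q : Part α π), q ∈ P.parts c →
      ConsistentT Prod.fst C K R (P.partGen c P.genT i q) ∧ (P.partGen c P.genT i q).rootStep ≤ P.step c ∧
        (2 ≤ (P.parts c).length → P.step c < (P.partGen c P.genT i q).reach (dictWT Prod.fst R C.n₁)) := by
    intro i q hq
    rcases q with ⟨c', r⟩ | ⟨d, x⟩
    · have hlt := P.step_lt c c' r hq
      have ih := consistentT_genT hT c'
      have hrs : (P.genT c').rootStep ≤ P.step c := (P.rootStep_genT_le c').trans hlt.le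
      rcases r with _ | _
      · exact ⟨ih, hrs, fun h2 => hT.alive c c' hq h2⟩
      · have hs := hT.renew_step c c' hq
        have hr := hT.renew_reach c c' hq
        refine ⟨?_, hrs, fun _ => ?_⟩
        · simp only [partGen, ConsistentT]
          exact ⟨ih, rfl, hs.symm, by rw [hs]; exact hr, by rw [hs]; exact hT.step_le c⟩
        · simp only [partGen, Gen.reach_renew, dictWT_fst, dictW_renew]
          omega
    · refine ⟨?_, le_of_eq (by rw [rootStep_partGen]), fun _ => ?_⟩
      · simp only [partGen, ConsistentT]
        exact ⟨rfl, rfl, hT.step_le c⟩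
      · simp only [partGen, Gen.reach_born, dictWT_fst, dictW_birth]
        omega
  unfold partsGen
  cases hps : P.parts c with
  | nil =>
      simp only [partsGenAux_nil, join, ConsistentT]
      exact ⟨rfl, rfl, hT.step_le c⟩
  | cons p ps =>
      rw [partsGenAux_cons]
      have hsub : ∀ q ∈ p :: ps, q ∈ P.parts c := fun q hq => by rw [hps]; exact hq
      cases ps with
      | nil => exact (hpart 0 p (hsub p List.mem_cons_self)).1
      | cons p' ps' =>
          have h2 : 2 ≤ (P.parts c).length := by rw [hps]; simp
          obtain ⟨hc0, hr0, hl0⟩ := hpart 0 p (hsub p List.mem_cons_self)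
          refine consistentT_chainMerge (hT.step_le c) hc0 hr0 (hl0 h2) (fun H hH => ?_) fun i _ => ⟨rfl, rfl⟩
          obtain ⟨k, q, hq, rfl⟩ := P.mem_partsGenAux hH
          obtain ⟨h1, h2', h3⟩ := hpart _ q (hsub q (List.mem_cons_of_mem _ hq))
          exact ⟨h1, h2', h3 h2⟩
termination_by P.step c
decreasing_by exact hlt

variable [DecidableEq α] [DecidableEq π]

/-- **… AND WELL FORMED** for the tagged table, on a forest (`freshT_genT`) — the socket's `ConsistentT ∧ FreshT ∧ WF`
triple for every component, from DISPLAYED timing facts and the forest property only. [folklore] -/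
theorem wf_genT (hF : ∀ c, P.Forest c) (hT : P.Timed K (dictWT Prod.fst R C.n₁)) (c : α) :
    (P.genT c).WF (dictWT Prod.fst R C.n₁) :=
  wf_of_consistentT_freshT (consistentT_genT hT c) (P.freshT_genT hF c)

end Pedigree

end Timed

/-! ## §3 The canonical chronology of the tree count -/

section Canon

variable {α π : Type*} [DecidableEq α] [DecidableEq π] (P : Pedigree α π)

namespace Pedigree

/-- **OLDEST LINE FIRST** at `c`: the first part's line is born no later than every other part's line, and a component
with several parts is headed by an OLD part (so the chain's root step is STRICTLY before the join step — the tree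
count records mergers strictly after the root birth).  The geometric layer lists parts in contact order from the
oldest constituent. [folklore] -/
def HeadOldest : α → Prop := fun c =>
  ∀ G Gs, P.partsGen c P.genT = G :: Gs →
    (∀ H ∈ Gs, G.rootStep ≤ H.rootStep) ∧ (Gs ≠ [] → G.rootStep < P.step c)

variable {P}

/-- the latest event step of the tagged genealogy is at most the component's step [folklore] -/
theorem maxStep_genT_le (c : α) : T4CanonicalMenus.maxStep (PEv.step ∘ Prod.fst) (P.genT c) ≤ P.step c :=
  maxStep_le_of_eventsLE (P.staged_genT c).eventsLE

/-- **THE TAGGED GENEALOGY OF AN OLDEST-LINE-FIRST PEDIGREE IS CANONICALLY CHRONOLOGICAL**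
(`T4CanonicalMenus.Chrono (PEv.step ∘ Prod.fst)`, the membership half of the tree count's `canonFam`). [folklore] -/
theorem chronoC_genT (hH : ∀ c, P.HeadOldest c) (c : α) :
    T4CanonicalMenus.Chrono (PEv.step ∘ Prod.fst) (P.genT c) := by
  have hHc := hH c
  rw [genT_eq]
  unfold HeadOldest partsGen at hHc
  unfold partsGen
  -- part genealogies are chronological with events dated ≤ step c
  have hpart : ∀ (i : ℕ) (q : Part α π), q ∈ P.parts c →
      T4CanonicalMenus.Chrono (PEv.step ∘ Prod.fst) (P.partGen c P.genT i q) ∧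
        T4CanonicalMenus.maxStep (PEv.step ∘ Prod.fst) (P.partGen c P.genT i q) ≤ P.step c := by
    intro i q hq
    rcases q with ⟨c', r⟩ | ⟨d, x⟩
    · have hlt := P.step_lt c c' r hq
      have ih := chronoC_genT hH c'
      have hm := (maxStep_genT_le (P := P) c').trans hlt.le
      rcases r with _ | _
      · exact ⟨ih, hm⟩
      · refine ⟨?_, ?_⟩
        · simp only [partGen, T4CanonicalMenus.chrono_renew_iff]
          exact ⟨ih, (P.rootStep_genT_le c').trans_lt hlt, hm⟩
        · simp only [partGen, T4CanonicalMenus.maxStep_renew]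
          exact max_le hm le_rfl
    · simp [partGen]
  cases hps : P.parts c with
  | nil => simp [join]
  | cons p ps =>
      rw [hps] at hHc
      rw [partsGenAux_cons] at hHc ⊢
      obtain ⟨hle, hlt⟩ := hHc _ _ rfl
      have hsub : ∀ q ∈ p :: ps, q ∈ P.parts c := fun q hq => by rw [hps]; exact hq
      cases ps with
      | nil => exact (hpart 0 p (hsub p List.mem_cons_self)).1
      | cons p' ps' =>
          obtain ⟨hc0, hm0⟩ := hpart 0 p (hsub p List.mem_cons_self)
          refine chronoC_chainMerge hc0 (hlt (by simp)) hm0 (fun H hH => ?_) fun i _ => rfl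
          obtain ⟨k, q, hq, rfl⟩ := P.mem_partsGenAux hH
          obtain ⟨h1, h3⟩ := hpart _ q (hsub q (List.mem_cons_of_mem _ hq))
          exact ⟨h1, hle _ hH, h3⟩
termination_by P.step c
decreasing_by exact hlt

end Pedigree

end Canon

/-! ## §4 One shape function -/

section Shape

variable {α π : Type*} [DecidableEq α] [DecidableEq π] (P : Pedigree α π)

namespace Pedigree

/-- relabelling along maps that agree on the events [folklore] -/
theorem relabel_congr {ε δ : Type*} [DecidableEq ε] {f g : ε → δ} :
    ∀ {G : Gen ε}, (∀ e ∈ G.events, f e = g e) → relabel f G = relabel g G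
  | Gen.born b j, h => by simp [h b (by simp)]
  | Gen.renew G e k, h => by
      rw [relabel_renew, relabel_renew, h e (by simp), relabel_congr fun e' he' => h e' (by simp [he'])]
  | Gen.merge X Y e, h => by
      rw [relabel_merge, relabel_merge, h e (by simp), relabel_congr fun e' he' => h e' (by simp [he']),
        relabel_congr fun e' he' => h e' (by simp [he'])]

/-- relabelling is the zone chain's `gmap` [folklore] -/
theorem relabel_eq_gmap' {ε δ : Type*} (f : ε → δ) : ∀ G : Gen ε, relabel f G = gmap f G
  | Gen.born _ _ => rfl
  | Gen.renew G e k => by rw [relabel_renew, relabel_eq_gmap' f G]; rfl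
  | Gen.merge X Y e => by rw [relabel_merge, relabel_eq_gmap' f X, relabel_eq_gmap' f Y]; rfl

variable {P}

/-- the shapes of the tagged genealogy's events are already canonical: kinds `1`∕`2` carry class `0` [folklore] -/
theorem shape_fst_of_mem_events (c : α) : ∀ e ∈ (P.genT c).events, shape e.1 = e.1 := by
  intro e he
  rw [genT_eq] at he
  unfold partsGen at he
  cases hps : P.parts c with
  | nil =>
      rw [hps, partsGenAux_nil] at he
      simp only [join, Gen.events_born, mem_singleton] at he
      subst he; rfl
  | cons p ps =>
      rw [hps, partsGenAux_cons, mem_events_join] at he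
      rcases he with ⟨H, hH, he⟩ | ⟨i, -, rfl⟩
      · rw [← partsGenAux_cons] at hH
        obtain ⟨k, q, hq, rfl⟩ := P.mem_partsGenAux hH
        rcases q with ⟨c', _ | _⟩ | ⟨d, x⟩
        · have hlt := P.step_lt c c' false (by rw [hps]; exact hq)
          exact shape_fst_of_mem_events c' e he
        · simp only [partGen, Gen.events_renew, mem_insert] at he
          rcases he with rfl | he
          · rfl
          · have hlt := P.step_lt c c' true (by rw [hps]; exact hq)
            exact shape_fst_of_mem_events c' e he
        · simp only [partGen, Gen.events_born, mem_singleton] at he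
          subst he; rfl
      · rfl
termination_by P.step c
decreasing_by all_goals exact hlt

/-- **ONE SHAPE FUNCTION** (R-OWNER-22-1 R3): the tree count's shape-relabelling of the tagged genealogy IS the flat
genealogy, `relabel (shape ∘ Prod.fst) (genT c) = gen c`. [folklore] -/
theorem relabel_shape_genT (c : α) : relabel (shape ∘ Prod.fst) (P.genT c) = P.gen c := by
  have h : relabel (shape ∘ Prod.fst) (P.genT c) = relabel Prod.fst (P.genT c) :=
    relabel_congr (f := shape ∘ Prod.fst) (g := Prod.fst) fun e he => P.shape_fst_of_mem_events c e he
  rw [h, relabel_eq_gmap']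
  rfl

end Pedigree

end Shape


end Summit.QuantumFields.BalabanUV.T4Continuum.HistoryGen
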